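import Summits.AtomisticToContinuum.HydrodynamicLimit.Theorems.MourreKoopmanChargesLinearToEntropyInBandVisCoreNToolkit
import Literature.Analysis.FluidPDE.HardSphereTrajectoryMeasurable
import Literature.Analysis.FluidPDE.HardSphereCollisionTimeMeasurable
import Literature.Analysis.FluidPDE.HardSphereFlowMeasurable
import HarnessLib

/-!
# Route `MourreKoopmanCharges`, crux `LinearToEntropyInBand` (stmt-AtomisticToContinuum-17740), skeleton v7:
# toolkit for the visible window functional `visCoreN` — part B (activity bound of the collision piece, measurability)

Registered toolkit stub `stub_visCoreNToolkitB` (`--supports` the crux; wave 6), continuing part A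
(`…VisCoreNToolkit`: named pieces, linearity, kinetic bound, collision-pair-sum form), for the v7 stubs 4a-i
`stub_visibleOneBlockEstimateInBand` and 4a-ii `stub_windowClauseOfOneBlockInBand` (AUDIT-4a § 2 (e1)–(e3), § 3 item 5).
No definition, no posited object; nothing restates the crux or a stub.

* § 1 ACTIVITY BOUND OF THE COLLISION PIECE (AUDIT-4a § 2 (e1)–(e2)): per particle
  `|visCollTermN| ≤ 𝟙(visible before ∧ after) (ε_N/2)(3a‖Δv‖ + a₄|Δ‖v‖²|/2)` (`‖A_j‖_∞ ≤ a`, `‖A₄‖_∞ ≤ a₄`), and on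
  the good set, for a bounded set of times `S`, the collision pair sum of part A § 3 is dominated by
  `(ε_N/2) max(3a, a₄) · Φ.collisionSum S (‖Δv_fst‖ + |Δ‖v_fst‖²|/2)` — the record functional of
  `MeanWindowTransferActivityBelow` summed over particles: the freeze / time-grid remainders of 4a-ii (fields of
  sup-norm `O(Δs)`) and the pricing of `visCoreN(small field)` go through it; the visibility indicator is kept in the
  per-particle form for the visible/invisible split.
* § 2 MEASURABILITY (needed because `VisibleOneBlockEstimateInBand` asserts `Integrable`): `VisibleN` is a
  measurable event, `visKinN`, `visFluxN` (Fubini over `𝕋³`; `hsCompressibility` is measurable as `deriv` of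
  anything is) are measurable in the configuration, `visCollTermN` jointly in the two configurations (parametric
  segment integral), and the ENGINE `measurable_collisionPairSum_Ioc_comp_subtype`: along any hard-sphere flow on
  `𝕋³`, a collision pair sum over `(a, b]`, `0 ≤ a`, of a measurable CONFIGURATION-LEVEL summand `g y i j` (not only
  a mark functional, which the label engines of `EmpiricalCollisionMeasureMeasurableLabels` cover) is measurable on
  the good set — particle by particle the collisions in `(0, h]` are enumerated by the measurable
  `Φ.nthCollisionTimeOf` (`HardSphereCollisionTimeMeasurable`, `HardSphereWindowEnumeration`), the sum clamped at
  index `K` is measurable and eventually (in `K`) the full one.  Part C assembles the measurable good version of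
  `visCoreN` and the good-set additivity.

References: I. Gallagher, L. Saint-Raymond, B. Texier, *From Newton to Boltzmann* (2013) § 4.1, Prop. 4.1.1;
C. Cercignani, R. Illner, M. Pulvirenti, *The Mathematical Theory of Dilute Gases* (1994) App. 4.A.
-/

noncomputable section

open MeasureTheory Filter Set
open scoped ENNReal Topology InnerProductSpace BigOperators

namespace Summit.AtomisticToContinuum.HydrodynamicLimit.Theorems.LTEInBand

open Literature.MathematicalPhysics.KineticTheory Literature.Analysis.FluidPDE Literature.Analysis.FunctionSpaces

/-! ## § 1 Activity bound of the collision piece (AUDIT-4a § 2 (e1)–(e2)) -/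

section Collision

variable (ρs : T3 → ℝ) (us : T3 → V3) (R K : ℝ) (N : ℕ)

/-- The unit vector of a (possibly null) momentum transfer has norm at most one. -/
theorem norm_inv_norm_smul_le_one (Δ : V3) : ‖‖Δ‖⁻¹ • Δ‖ ≤ 1 := by
  rcases eq_or_ne Δ 0 with rfl | hΔ
  exacts [by simp, by rw [norm_smul, norm_inv, norm_norm, inv_mul_cancel₀ (norm_ne_zero_iff.2 hΔ)]]

/-- **Per-particle bound of the collision term** by the transfer activity of the particle: with
`‖A_j‖_∞ ≤ a`, `‖A₄‖_∞ ≤ a₄`, `0 ≤ σ`,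
`|term_i| ≤ 𝟙(i visible before and after) · (ε_N/2) (3a ‖Δvᵢ‖ + a₄ |Δ‖vᵢ‖²|/2)`. -/
theorem abs_visCollTermN_le {σ : ℝ} {A₄ : T3 → V3} {A : Fin 3 → T3 → V3} {a a₄ : ℝ} (hA : ∀ j x, ‖A j x‖ ≤ a)
    (hA₄ : ∀ x, ‖A₄ x‖ ≤ a₄) (hσ : 0 ≤ σ) (yl yr : Config (N + 1) (Fin 3) T3) (i : Fin (N + 1)) :
    |visCollTermN σ ρs us A₄ A R K N yl yr i| ≤
      (if VisibleN ρs us R K N yl i ∧ VisibleN ρs us R K N yr i then 1 else 0) *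
        (hsDiameter σ N / 2 * (3 * a * ‖(yr i).2 - (yl i).2‖ + a₄ * |‖(yr i).2‖ ^ 2 - ‖(yl i).2‖ ^ 2| / 2)) := by
  have hε : 0 ≤ hsDiameter σ N := mul_nonneg hσ (Real.rpow_nonneg (by positivity) _)
  have ha : 0 ≤ a := (norm_nonneg _).trans (hA 0 0)
  have ha₄ : 0 ≤ a₄ := (norm_nonneg _).trans (hA₄ 0)
  unfold visCollTermN
  dsimp only
  split_ifs with hvis
  · rw [one_mul, abs_mul, abs_of_nonneg (by positivity : 0 ≤ hsDiameter σ N / 2)]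
    refine mul_le_mul_of_nonneg_left ?_ (by positivity)
    set Δ : V3 := (yr i).2 - (yl i).2 with hΔ
    set ω : V3 := ‖Δ‖⁻¹ • Δ with hω
    have hω1 : ‖ω‖ ≤ 1 := norm_inv_norm_smul_le_one Δ
    have hb := intervalIntegral.norm_integral_le_of_norm_le_const (a := (0 : ℝ)) (b := 1)
      (C := 3 * a * ‖Δ‖ + a₄ * |‖(yr i).2‖ ^ 2 - ‖(yl i).2‖ ^ 2| / 2)
      (f := fun r : ℝ => (∑ j, ⟪A j ((yr i).1 + Torus.proj (-(r * hsDiameter σ N) • ω)), ω⟫_ℝ * Δ j) +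
        ⟪A₄ ((yr i).1 + Torus.proj (-(r * hsDiameter σ N) • ω)), ω⟫_ℝ * (‖(yr i).2‖ ^ 2 - ‖(yl i).2‖ ^ 2) / 2) ?_
    · simpa only [sub_zero, abs_one, mul_one, Real.norm_eq_abs] using hb
    intro r _
    rw [Real.norm_eq_abs]
    refine (abs_add_le _ _).trans (add_le_add ((Finset.abs_sum_le_sum_abs _ _).trans ?_) ?_)
    · have h3 : ∑ _j : Fin 3, a * ‖Δ‖ = 3 * a * ‖Δ‖ := by
        rw [Finset.sum_const, Finset.card_univ, Fintype.card_fin, nsmul_eq_mul]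
        push_cast; ring
      rw [← h3]
      refine Finset.sum_le_sum fun j _ => ?_
      rw [abs_mul]
      have h1 : |⟪A j ((yr i).1 + Torus.proj (-(r * hsDiameter σ N) • ω)), ω⟫_ℝ| ≤ a :=
        (abs_real_inner_le_norm _ _).trans ((mul_le_mul (hA j _) hω1 (norm_nonneg _) ha).trans_eq (mul_one a))
      have h2 : |Δ j| ≤ ‖Δ‖ := by simpa using PiLp.norm_apply_le Δ j
      exact mul_le_mul h1 h2 (abs_nonneg _) ha
    · rw [abs_div, abs_mul, abs_two]
      have h1 : |⟪A₄ ((yr i).1 + Torus.proj (-(r * hsDiameter σ N) • ω)), ω⟫_ℝ| ≤ a₄ :=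
        (abs_real_inner_le_norm _ _).trans ((mul_le_mul (hA₄ _) hω1 (norm_nonneg _) ha₄).trans_eq (mul_one a₄))
      rw [mul_div_assoc, mul_div_assoc]
      exact mul_le_mul h1 le_rfl (by positivity) ha₄
  · simp

/-- **The collision piece is dominated by the window transfer activity** (good data, bounded `S`):
`|Φ.collisionPairSum S g z| ≤ (ε_N/2) max(3a, a₄) · Σ_(collisions c in S) (‖Δv_fst‖ + |Δ‖v_fst‖²|/2)` — the
record functional of `MeanWindowTransferActivityBelow` summed over the particles (AUDIT-4a § 2 (e2)–(e3): the
freeze / time-grid remainders of 4a-ii are fields of sup-norm `O(Δs)` inserted here). -/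
theorem abs_collisionPairSum_visCollTermN_le {σ : ℝ} {A₄ : T3 → V3} {A : Fin 3 → T3 → V3} {a a₄ : ℝ}
    (hA : ∀ j x, ‖A j x‖ ≤ a) (hA₄ : ∀ x, ‖A₄ x‖ ≤ a₄) (hσ : 0 ≤ σ)
    (Φ : HardSphereFlow (Torus.geometry (Fin 3)) (hsDiameter σ N) (N + 1)) {z : Config (N + 1) (Fin 3) T3}
    (hz : z ∈ Φ.good) {S : Set ℝ} {t₁ t₂ : ℝ} (hS : S ⊆ Set.Icc t₁ t₂) :
    |Φ.collisionPairSum S (fun _ y i j =>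
        visCollTermN σ ρs us A₄ A R K N (collidePair (Torus.geometry (Fin 3)) i j y) y i) z| ≤
      hsDiameter σ N / 2 * max (3 * a) a₄ *
        Φ.collisionSum S (fun c => ‖c.postVel.1 - c.preVel.1‖ + |‖c.postVel.1‖ ^ 2 - ‖c.preVel.1‖ ^ 2| / 2) z := by
  have hε : 0 ≤ hsDiameter σ N := mul_nonneg hσ (Real.rpow_nonneg (by positivity) _)
  have hfin := Φ.finite_collisionTimes_inter hz hS
  rw [HardSphereFlow.collisionSum_eq_collisionPairSum, HardSphereFlow.collisionPairSum, HardSphereFlow.collisionPairSum,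
    collisionPairSum_eq_finset_sum hfin, collisionPairSum_eq_finset_sum hfin, Finset.mul_sum]
  refine (Finset.abs_sum_le_sum_abs _ _).trans (Finset.sum_le_sum fun t _ => ?_)
  rw [Finset.mul_sum]
  refine (Finset.abs_sum_le_sum_abs _ _).trans (Finset.sum_le_sum fun e he => ?_)
  obtain ⟨hij, -⟩ := mem_contactPairs.1 he
  rw [HardSphereCollisionRecord.ofConfig_preVel_eq_collidePair _ _ _ _ hij, HardSphereCollisionRecord.ofConfig_postVel]
  refine (abs_visCollTermN_le ρs us R K N hA hA₄ hσ _ _ _).trans ?_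
  set y := Φ.flow t z
  set Δ : ℝ := ‖(y e.1).2 - (collidePair (Torus.geometry (Fin 3)) e.1 e.2 y e.1).2‖ with hΔ
  set Δe : ℝ := |‖(y e.1).2‖ ^ 2 - ‖(collidePair (Torus.geometry (Fin 3)) e.1 e.2 y e.1).2‖ ^ 2| with hΔe
  have hΔ0 : 0 ≤ Δ := norm_nonneg _
  have hΔe0 : 0 ≤ Δe := abs_nonneg _
  have hind : (if VisibleN ρs us R K N (collidePair (Torus.geometry (Fin 3)) e.1 e.2 y) e.1 ∧ VisibleN ρs us R K N y e.1
      then (1 : ℝ) else 0) ≤ 1 := by split_ifs <;> norm_num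
  have hind0 : 0 ≤ (if VisibleN ρs us R K N (collidePair (Torus.geometry (Fin 3)) e.1 e.2 y) e.1 ∧ VisibleN ρs us R K N y e.1
      then (1 : ℝ) else 0) := by split_ifs <;> norm_num
  have ha : 0 ≤ a := (norm_nonneg _).trans (hA 0 0)
  have ha₄ : 0 ≤ a₄ := (norm_nonneg _).trans (hA₄ 0)
  have h1 : 3 * a * Δ + a₄ * Δe / 2 ≤ max (3 * a) a₄ * (Δ + Δe / 2) := by
    rw [mul_add]
    exact add_le_add (mul_le_mul_of_nonneg_right (le_max_left _ _) hΔ0)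
      (by rw [mul_div_assoc]; exact mul_le_mul_of_nonneg_right (le_max_right _ _) (by positivity))
  calc _ ≤ 1 * (hsDiameter σ N / 2 * (3 * a * Δ + a₄ * Δe / 2)) :=
        mul_le_mul_of_nonneg_right hind (by positivity)
    _ ≤ 1 * (hsDiameter σ N / 2 * (max (3 * a) a₄ * (Δ + Δe / 2))) :=
        mul_le_mul_of_nonneg_left (mul_le_mul_of_nonneg_left h1 (by positivity)) zero_le_one
    _ = _ := by ring

end Collision

/-! ## § 2 Measurability -/

section Measurability

variable {ρs : T3 → ℝ} {us : T3 → V3} {A₀ A₄ : T3 → V3} {A : Fin 3 → T3 → V3}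

/-- The cone kernel composed with measurable torus-valued maps is measurable. -/
theorem measurable_cone_comp {α : Type*} [MeasurableSpace α] (a : ℝ) (M : ℕ) {f g : α → T3} (hf : Measurable f)
    (hg : Measurable g) : Measurable fun x => cone a M (f x) (g x) := by
  unfold cone
  have h : Measurable fun x => Torus.euclidDist (f x) (g x) := by
    simp only [Torus.euclidDist_eq]
    exact (Torus.measurable_reprSym.comp (hf.sub hg)).norm
  exact measurable_const.mul (measurable_const.max (measurable_const.sub (h.div_const _)))

/-- Visibility is a measurable event of the configuration (measurable reference fields). -/
theorem measurableSet_visibleN (hρs : Measurable ρs) (hus : Measurable us) (R K : ℝ) (N : ℕ) (i : Fin (N + 1)) :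
    MeasurableSet {y : Config (N + 1) (Fin 3) T3 | VisibleN ρs us R K N y i} := by
  have hx : Measurable fun y : Config (N + 1) (Fin 3) T3 => (y i).1 := (measurable_pi_apply i).fst
  have hv : Measurable fun y : Config (N + 1) (Fin 3) T3 => (y i).2 := (measurable_pi_apply i).snd
  have h1 : Measurable fun y : Config (N + 1) (Fin 3) T3 => ‖(y i).2 - us (y i).1‖ := (hv.sub (hus.comp hx)).norm
  have h2 : Measurable fun y : Config (N + 1) (Fin 3) T3 => ((N : ℝ) + 1)⁻¹ * ∑ j, cone R N (y i).1 (y j).1 :=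
    measurable_const.mul (Finset.measurable_sum _ fun j _ => measurable_cone_comp R N hx (measurable_pi_apply j).fst)
  have h3 : Measurable fun y : Config (N + 1) (Fin 3) T3 => 3 / 2 * ρs (y i).1 := measurable_const.mul (hρs.comp hx)
  have hset : {y : Config (N + 1) (Fin 3) T3 | VisibleN ρs us R K N y i} = {y | ‖(y i).2 - us (y i).1‖ ≤ K} ∩
      {y | ((N : ℝ) + 1)⁻¹ * ∑ j, cone R N (y i).1 (y j).1 ≤ 3 / 2 * ρs (y i).1} := Set.ext fun _ => Iff.rfl
  rw [hset]
  exact (measurableSet_le h1 measurable_const).inter (measurableSet_le h2 h3)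

/-- The kinetic piece is a measurable function of the configuration. -/
theorem measurable_visKinN (hρs : Measurable ρs) (hus : Measurable us) (hA₀ : Measurable A₀) (hA₄ : Measurable A₄)
    (hA : ∀ j, Measurable (A j)) (R K : ℝ) (N : ℕ) : Measurable (visKinN ρs us A₀ A₄ A R K N) := by
  unfold visKinN
  refine Finset.measurable_sum _ fun i _ => Measurable.ite (measurableSet_visibleN hρs hus R K N i) ?_ measurable_const
  have hx : Measurable fun y : Config (N + 1) (Fin 3) T3 => (y i).1 := (measurable_pi_apply i).fst
  have hv : Measurable fun y : Config (N + 1) (Fin 3) T3 => (y i).2 := (measurable_pi_apply i).snd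
  exact (((hA₀.comp hx).inner hv).add (Finset.measurable_sum _ fun j _ =>
    (((hA j).comp hx).inner hv).mul ((PiLp.continuous_apply 2 _ j).measurable.comp hv))).add
    ((((hA₄.comp hx).inner hv).mul (hv.norm.pow_const 2)).div_const _)

/-- The three visible block fields are jointly measurable in (configuration, point). -/
theorem measurable_visBlockFields (hρs : Measurable ρs) (hus : Measurable us) (R K k : ℝ) (N : ℕ) :
    (Measurable fun q : Config (N + 1) (Fin 3) T3 × T3 => visDensityN ρs us R K k N q.1 q.2) ∧
      (Measurable fun q : Config (N + 1) (Fin 3) T3 × T3 => visMomentumN ρs us R K k N q.1 q.2) ∧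
      (Measurable fun q : Config (N + 1) (Fin 3) T3 × T3 => visEnergyN ρs us R K k N q.1 q.2) := by
  have hS : ∀ i, MeasurableSet {q : Config (N + 1) (Fin 3) T3 × T3 | VisibleN ρs us R K N q.1 i} := fun i =>
    measurable_fst (measurableSet_visibleN hρs hus R K N i)
  have hx : ∀ i, Measurable fun q : Config (N + 1) (Fin 3) T3 × T3 => (q.1 i).1 := fun i =>
    ((measurable_pi_apply i).comp measurable_fst).fst
  have hv : ∀ i, Measurable fun q : Config (N + 1) (Fin 3) T3 × T3 => (q.1 i).2 := fun i =>
    ((measurable_pi_apply i).comp measurable_fst).snd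
  have hb : ∀ i, Measurable fun q : Config (N + 1) (Fin 3) T3 × T3 => cone k N q.2 (q.1 i).1 := fun i =>
    measurable_cone_comp k N measurable_snd (hx i)
  refine ⟨?_, ?_, ?_⟩
  · unfold visDensityN
    exact measurable_const.mul (Finset.measurable_sum _ fun i _ => Measurable.ite (hS i) (hb i) measurable_const)
  · unfold visMomentumN
    exact (Finset.measurable_sum _ fun i _ => Measurable.ite (hS i) ((hb i).smul (hv i)) measurable_const).const_smul
      (((N : ℝ) + 1)⁻¹)
  · unfold visEnergyN
    exact measurable_const.mul (Finset.measurable_sum _ fun i _ =>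
      Measurable.ite (hS i) (((hb i).mul ((hv i).norm.pow_const 2)).div_const _) measurable_const)

/-- The compressibility factor composed with a measurable map is measurable (`deriv` of anything is measurable). -/
theorem measurable_hsCompressibility_comp {α : Type*} [MeasurableSpace α] {f : α → ℝ} (hf : Measurable f) :
    Measurable fun x => hsCompressibility (f x) := by
  have h : Measurable hsCompressibility := by
    unfold hsCompressibility
    exact measurable_const.add (measurable_id.mul (measurable_deriv _))
  simpa only [Function.comp_def] using h.comp hf

/-- The Euler-flux density of the visible block fields is jointly measurable in (configuration, point). -/
theorem measurable_visFluxDensityN {σ : ℝ} (hρs : Measurable ρs) (hus : Measurable us) (hA₀ : Measurable A₀)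
    (hA₄ : Measurable A₄) (hA : ∀ j, Measurable (A j)) (R K k : ℝ) (N : ℕ) :
    Measurable fun q : Config (N + 1) (Fin 3) T3 × T3 => visFluxDensityN σ ρs us A₀ A₄ A R K k N q.1 q.2 := by
  obtain ⟨hρ, hm, he⟩ := measurable_visBlockFields hρs hus R K k N
  have hwb : Measurable fun q : Config (N + 1) (Fin 3) T3 × T3 =>
      (visDensityN ρs us R K k N q.1 q.2)⁻¹ • visMomentumN ρs us R K k N q.1 q.2 := hρ.inv.smul hm
  have hp : Measurable fun q : Config (N + 1) (Fin 3) T3 × T3 =>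
      visDensityN ρs us R K k N q.1 q.2 * (2 / 3 * (visEnergyN ρs us R K k N q.1 q.2 / visDensityN ρs us R K k N q.1 q.2 -
        ‖(visDensityN ρs us R K k N q.1 q.2)⁻¹ • visMomentumN ρs us R K k N q.1 q.2‖ ^ 2 / 2)) *
        hsCompressibility (min (visDensityN ρs us R K k N q.1 q.2) (2 * ρs q.2) * σ ^ 3) :=
    (hρ.mul (measurable_const.mul ((he.div hρ).sub ((hwb.norm.pow_const 2).div_const _)))).mul
      (measurable_hsCompressibility_comp ((hρ.min (measurable_const.mul (hρs.comp measurable_snd))).mul measurable_const))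
  have hc : ∀ j, Measurable fun v : V3 => v j := fun j => (PiLp.continuous_apply 2 _ j).measurable
  unfold visFluxDensityN
  dsimp only
  exact ((((hA₀.comp measurable_snd).inner hm).add (Finset.measurable_sum _ fun j _ =>
    ((((hA j).comp measurable_snd).inner hm).mul ((hc j).comp hwb)).add (hp.mul ((hc j).comp ((hA j).comp measurable_snd))))).add
    (((hA₄.comp measurable_snd).inner hwb).mul (he.add hp)))

/-- The flux piece is a measurable function of the configuration (Fubini measurability over `𝕋³`). -/
theorem measurable_visFluxN {σ : ℝ} (hρs : Measurable ρs) (hus : Measurable us) (hA₀ : Measurable A₀)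
    (hA₄ : Measurable A₄) (hA : ∀ j, Measurable (A j)) (R K k : ℝ) (N : ℕ) :
    Measurable (visFluxN σ ρs us A₀ A₄ A R K k N) := by
  unfold visFluxN
  exact measurable_const.mul
    ((measurable_visFluxDensityN hρs hus hA₀ hA₄ hA R K k N).stronglyMeasurable.integral_prod_right' (ν := volume)).measurable

/-- The collision term of a particle is jointly measurable in the (pre-, post-)collisional configurations
(parametric contact-segment integral of a jointly measurable integrand). -/
theorem measurable_visCollTermN {σ : ℝ} (hρs : Measurable ρs) (hus : Measurable us) (hA₄ : Measurable A₄)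
    (hA : ∀ j, Measurable (A j)) (R K : ℝ) (N : ℕ) (i : Fin (N + 1)) :
    Measurable fun q : Config (N + 1) (Fin 3) T3 × Config (N + 1) (Fin 3) T3 => visCollTermN σ ρs us A₄ A R K N q.1 q.2 i := by
  have hc : ∀ j, Measurable fun v : V3 => v j := fun j => (PiLp.continuous_apply 2 _ j).measurable
  have hvl : Measurable fun q : Config (N + 1) (Fin 3) T3 × Config (N + 1) (Fin 3) T3 => (q.1 i).2 :=
    ((measurable_pi_apply i).comp measurable_fst).snd
  have hvr : Measurable fun q : Config (N + 1) (Fin 3) T3 × Config (N + 1) (Fin 3) T3 => (q.2 i).2 :=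
    ((measurable_pi_apply i).comp measurable_snd).snd
  have hxr : Measurable fun q : Config (N + 1) (Fin 3) T3 × Config (N + 1) (Fin 3) T3 => (q.2 i).1 :=
    ((measurable_pi_apply i).comp measurable_snd).fst
  have hΔ : Measurable fun q : Config (N + 1) (Fin 3) T3 × Config (N + 1) (Fin 3) T3 => (q.2 i).2 - (q.1 i).2 := hvr.sub hvl
  have hω : Measurable fun q : Config (N + 1) (Fin 3) T3 × Config (N + 1) (Fin 3) T3 =>
      ‖(q.2 i).2 - (q.1 i).2‖⁻¹ • ((q.2 i).2 - (q.1 i).2) := hΔ.norm.inv.smul hΔ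
  -- the segment integrand, jointly in (pair of configurations, parameter)
  have hH : Measurable fun qr : (Config (N + 1) (Fin 3) T3 × Config (N + 1) (Fin 3) T3) × ℝ =>
      (∑ j, ⟪A j ((qr.1.2 i).1 + Torus.proj (-(qr.2 * hsDiameter σ N) • (‖(qr.1.2 i).2 - (qr.1.1 i).2‖⁻¹ • ((qr.1.2 i).2 - (qr.1.1 i).2)))),
          ‖(qr.1.2 i).2 - (qr.1.1 i).2‖⁻¹ • ((qr.1.2 i).2 - (qr.1.1 i).2)⟫_ℝ * ((qr.1.2 i).2 - (qr.1.1 i).2) j) +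
        ⟪A₄ ((qr.1.2 i).1 + Torus.proj (-(qr.2 * hsDiameter σ N) • (‖(qr.1.2 i).2 - (qr.1.1 i).2‖⁻¹ • ((qr.1.2 i).2 - (qr.1.1 i).2)))),
          ‖(qr.1.2 i).2 - (qr.1.1 i).2‖⁻¹ • ((qr.1.2 i).2 - (qr.1.1 i).2)⟫_ℝ * (‖(qr.1.2 i).2‖ ^ 2 - ‖(qr.1.1 i).2‖ ^ 2) / 2 := by
    have hω' : Measurable fun qr : (Config (N + 1) (Fin 3) T3 × Config (N + 1) (Fin 3) T3) × ℝ =>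
        ‖(qr.1.2 i).2 - (qr.1.1 i).2‖⁻¹ • ((qr.1.2 i).2 - (qr.1.1 i).2) := hω.comp measurable_fst
    have hΔ' : Measurable fun qr : (Config (N + 1) (Fin 3) T3 × Config (N + 1) (Fin 3) T3) × ℝ =>
        (qr.1.2 i).2 - (qr.1.1 i).2 := hΔ.comp measurable_fst
    have hP : Measurable fun qr : (Config (N + 1) (Fin 3) T3 × Config (N + 1) (Fin 3) T3) × ℝ =>
        (qr.1.2 i).1 + Torus.proj (-(qr.2 * hsDiameter σ N) • (‖(qr.1.2 i).2 - (qr.1.1 i).2‖⁻¹ • ((qr.1.2 i).2 - (qr.1.1 i).2))) :=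
      (hxr.comp measurable_fst).add (Torus.measurable_proj.comp ((measurable_snd.mul measurable_const).neg.smul hω'))
    exact (Finset.measurable_sum _ fun j _ => (((hA j).comp hP).inner hω').mul ((hc j).comp hΔ')).add
      (((((hA₄.comp hP).inner hω').mul (((hvr.comp measurable_fst).norm.pow_const 2).sub
        ((hvl.comp measurable_fst).norm.pow_const 2)))).div_const _)
  have hI := (hH.stronglyMeasurable.integral_prod_right' (ν := volume.restrict (Set.Ioc (0 : ℝ) 1))).measurable
  unfold visCollTermN
  dsimp only
  simp_rw [intervalIntegral.integral_of_le zero_le_one]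
  refine Measurable.ite ?_ (measurable_const.mul hI) measurable_const
  exact (measurable_fst (measurableSet_visibleN hρs hus R K N i)).inter (measurable_snd (measurableSet_visibleN hρs hus R K N i))

/-- **Collision pair sums over `(0, h]` of a measurable configuration-level summand are measurable on the good
set** (`𝕋³`, any diameter): particle by particle the collisions of `i` in `(0, h]` are enumerated by the
measurable `Φ.nthCollisionTimeOf i n` (`HardSphereCollisionTimeMeasurable`), the sum clamped at `n ≤ K` is
measurable, and it is eventually (in `K`) the full sum. -/
theorem measurable_collisionPairSum_Ioc_zero_comp_subtype {n : ℕ} {ε : ℝ}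
    (Φ : HardSphereFlow (Torus.geometry (Fin 3)) ε n) {g : Config n (Fin 3) T3 → Fin n → Fin n → ℝ}
    (hg : ∀ i j, Measurable fun y => g y i j) (h : ℝ) :
    Measurable fun z : Φ.good => Φ.collisionPairSum (Set.Ioc 0 h) (fun _ y i j => g y i j) (z : Config n (Fin 3) T3) := by
  classical
  -- per-particle summand
  set G : Config n (Fin 3) T3 → Fin n → ℝ := fun y i =>
    ∑ j, if (i, j) ∈ contactPairs (Torus.geometry (Fin 3)) ε y then g y i j else 0 with hGdef
  have hGm : ∀ i, Measurable fun y => G y i := by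
    intro i
    refine Finset.measurable_sum _ fun j _ => Measurable.ite ?_ (hg i j) measurable_const
    have hset : {y : Config n (Fin 3) T3 | (i, j) ∈ contactPairs (Torus.geometry (Fin 3)) ε y} =
        {_y | i ≠ j} ∩ contactSet (Torus.geometry (Fin 3)) n ε i j := by
      ext y; simp [mem_contactPairs]
    rw [hset]
    exact (MeasurableSet.const _).inter (measurableSet_contactSet _ Torus.measurable_geometry_sepVec n ε i j)
  -- clamped approximants
  have hΨm : ∀ K : ℕ, Measurable fun z : Φ.good => ∑ i, ∑ m ∈ Finset.range (K + 1),
      (if m < (collisionTimesOf (Torus.geometry (Fin 3)) ε (fun s => Φ.flow s (z : Config n (Fin 3) T3)) i ∩ Set.Ioc 0 h).ncard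
        then G (Φ.flow (Φ.nthCollisionTimeOf i m (z : Config n (Fin 3) T3)) (z : Config n (Fin 3) T3)) i else 0) :=
    fun K => Φ.measurable_sum_ite_lt_ncard_comp_subtype_torus hGm K h
  refine measurable_of_tendsto_metrizable hΨm (tendsto_pi_nhds.2 fun z => ?_)
  have hz : (z : Config n (Fin 3) T3) ∈ Φ.good := z.2
  set J : Fin n → ℕ := fun i =>
    (collisionTimesOf (Torus.geometry (Fin 3)) ε (fun s => Φ.flow s (z : Config n (Fin 3) T3)) i ∩ Set.Ioc 0 h).ncard with hJ
  have hfin : (collisionTimes (Torus.geometry (Fin 3)) ε (fun s => Φ.flow s (z : Config n (Fin 3) T3)) ∩ Set.Ioc 0 h).Finite :=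
    Φ.finite_collisionTimes_inter hz Set.Ioc_subset_Icc_self
  have hfini : ∀ i, (collisionTimesOf (Torus.geometry (Fin 3)) ε (fun s => Φ.flow s (z : Config n (Fin 3) T3)) i ∩
      Set.Ioc 0 h).Finite := fun i =>
    hfin.subset (Set.inter_subset_inter_left _ (collisionTimesOf_subset _ i))
  -- the full sum, particle by particle, enumerated
  have hfull : Φ.collisionPairSum (Set.Ioc 0 h) (fun _ y i j => g y i j) (z : Config n (Fin 3) T3) =
      ∑ i, ∑ m ∈ Finset.range (J i),
        G (Φ.flow (Φ.nthCollisionTimeOf i m (z : Config n (Fin 3) T3)) (z : Config n (Fin 3) T3)) i := by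
    rw [HardSphereFlow.collisionPairSum, collisionPairSum_eq_finset_sum hfin]
    have h2 : ∀ y, ∑ p ∈ contactPairs (Torus.geometry (Fin 3)) ε y, g y p.1 p.2 = ∑ i, G y i := by
      intro y
      rw [← Finset.univ_inter (contactPairs (Torus.geometry (Fin 3)) ε y), ← Finset.sum_ite_mem,
        Fintype.sum_prod_type]
    simp_rw [h2]
    rw [Finset.sum_comm]
    refine Finset.sum_congr rfl fun i _ => ?_
    have hsub : (hfini i).toFinset ⊆ hfin.toFinset := Set.Finite.toFinset_subset_toFinset.2
      (Set.inter_subset_inter_left _ (collisionTimesOf_subset _ i))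
    rw [← Finset.sum_subset hsub]
    · have himage : (Finset.range (J i)).image (fun m => Φ.nthCollisionTimeOf i m (z : Config n (Fin 3) T3)) =
          (hfini i).toFinset := by
        ext t
        simp only [Finset.mem_image, Finset.mem_range, Set.Finite.mem_toFinset]
        constructor
        · rintro ⟨m, hm, rfl⟩
          exact Φ.nthCollisionTimeOf_mem_window hz i hm
        · intro ht
          obtain ⟨m, hm, hmt⟩ := Φ.exists_lt_ncard_nthCollisionTimeOf_eq hz i ht
          exact ⟨m, hm, hmt⟩
      rw [← himage, Finset.sum_image]
      intro x hx y hy hxy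
      exact (Φ.strictMonoOn_nthCollisionTimeOf_window hz i h).injOn (Set.mem_Iio.2 (Finset.mem_range.1 hx))
        (Set.mem_Iio.2 (Finset.mem_range.1 hy)) hxy
    · intro t ht hti
      have htw : t ∈ Set.Ioc 0 h := ((Set.Finite.mem_toFinset hfin).1 ht).2
      have hnp : ¬ Participates (Torus.geometry (Fin 3)) ε (Φ.flow t (z : Config n (Fin 3) T3)) i := fun hp =>
        hti ((Set.Finite.mem_toFinset (hfini i)).2 ⟨hp, htw⟩)
      exact Finset.sum_eq_zero fun j _ => if_neg fun hij => hnp ⟨j, Or.inl hij⟩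
  -- eventually the clamped sum is the full sum
  refine tendsto_atTop_of_eventually_const (i₀ := ∑ i, J i) fun K hK => ?_
  rw [hfull]
  refine Finset.sum_congr rfl fun i _ => ?_
  have hJK : J i ≤ K + 1 :=
    ((Finset.single_le_sum (fun _ _ => Nat.zero_le _) (Finset.mem_univ i)).trans hK).trans (Nat.le_succ K)
  rw [← Finset.sum_subset (Finset.range_mono hJK) fun m _ hmJ => if_neg fun hlt => hmJ (Finset.mem_range.2 hlt)]
  exact Finset.sum_congr rfl fun m hm => if_pos (Finset.mem_range.1 hm)

/-- The same on a window `(a, b]` with `0 ≤ a` (difference of two windows from `0`; empty if `b < a`). -/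
theorem measurable_collisionPairSum_Ioc_comp_subtype {n : ℕ} {ε : ℝ}
    (Φ : HardSphereFlow (Torus.geometry (Fin 3)) ε n) {g : Config n (Fin 3) T3 → Fin n → Fin n → ℝ}
    (hg : ∀ i j, Measurable fun y => g y i j) {a : ℝ} (ha : 0 ≤ a) (b : ℝ) :
    Measurable fun z : Φ.good => Φ.collisionPairSum (Set.Ioc a b) (fun _ y i j => g y i j) (z : Config n (Fin 3) T3) := by
  rcases lt_or_ge b a with hba | hab
  · have h0 : (fun z : Φ.good => Φ.collisionPairSum (Set.Ioc a b) (fun _ y i j => g y i j) (z : Config n (Fin 3) T3)) =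
        fun _ => 0 := by
      funext z
      rw [HardSphereFlow.collisionPairSum, Set.Ioc_eq_empty (not_lt.2 hba.le), collisionPairSum_empty]
    rw [h0]
    exact measurable_const
  · have heq : (fun z : Φ.good => Φ.collisionPairSum (Set.Ioc a b) (fun _ y i j => g y i j) (z : Config n (Fin 3) T3)) =
        fun z : Φ.good => Φ.collisionPairSum (Set.Ioc 0 b) (fun _ y i j => g y i j) (z : Config n (Fin 3) T3) -
          Φ.collisionPairSum (Set.Ioc 0 a) (fun _ y i j => g y i j) (z : Config n (Fin 3) T3) := by
      funext z
      rw [eq_sub_iff_add_eq', HardSphereFlow.collisionPairSum, HardSphereFlow.collisionPairSum, HardSphereFlow.collisionPairSum,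
        ← collisionPairSum_union (Φ.finite_collisionTimes_inter z.2 Set.Ioc_subset_Icc_self)
          (Φ.finite_collisionTimes_inter z.2 Set.Ioc_subset_Icc_self) (Set.Ioc_disjoint_Ioc_of_le le_rfl),
        Set.Ioc_union_Ioc_eq_Ioc ha hab]
    rw [heq]
    exact (measurable_collisionPairSum_Ioc_zero_comp_subtype Φ hg b).sub
      (measurable_collisionPairSum_Ioc_zero_comp_subtype Φ hg a)

end Measurability

/-! ## The registered toolkit stub -/

/-- **Registered toolkit stub `stub_visCoreNToolkitB` (part B)** of skeleton v7 (crux stmt-17740): the activity bound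
of the collision piece of `visCoreN` on the good set, and the measurability engine for collision pair sums of
configuration-level summands.  Sorry-free conjunction of `abs_collisionPairSum_visCollTermN_le` and
`measurable_collisionPairSum_Ioc_comp_subtype`. -/
theorem stub_visCoreNToolkitB : (∀ (σ : ℝ) (ρs : Literature.MathematicalPhysics.KineticTheory.T3 → ℝ) (us A₄ : Literature.MathematicalPhysics.KineticTheory.T3 → Literature.MathematicalPhysics.KineticTheory.V3) (A : Fin 3 → Literature.MathematicalPhysics.KineticTheory.T3 → Literature.MathematicalPhysics.KineticTheory.V3) (R K a a₄ : ℝ) (N : ℕ), (∀ j x, ‖A j x‖ ≤ a) → (∀ x, ‖A₄ x‖ ≤ a₄) → 0 ≤ σ → ∀ (Φ : Literature.Analysis.FluidPDE.HardSphereFlow (Literature.Analysis.FluidPDE.Torus.geometry (Fin 3)) (Literature.MathematicalPhysics.KineticTheory.hsDiameter σ N) (N + 1)) (z : Literature.Analysis.FluidPDE.Config (N + 1) (Fin 3) Literature.MathematicalPhysics.KineticTheory.T3), z ∈ Φ.good → ∀ (S : Set ℝ) (t₁ t₂ : ℝ), S ⊆ Set.Icc t₁ t₂ → |Φ.collisionPairSum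 S (fun _ y i j => Summit.AtomisticToContinuum.HydrodynamicLimit.Theorems.LTEInBand.visCollTermN σ ρs us A₄ A R K N (Literature.Analysis.FluidPDE.collidePair (Literature.Analysis.FluidPDE.Torus.geometry (Fin 3)) i j y) y i) z| ≤ Literature.MathematicalPhysics.KineticTheory.hsDiameter σ N / 2 * max (3 * a) a₄ * Φ.collisionSum S (fun c => ‖c.postVel.1 - c.preVel.1‖ + |‖c.postVel.1‖ ^ 2 - ‖c.preVel.1‖ ^ 2| / 2) z) ∧ (∀ (n : ℕ) (ε : ℝ) (Φ : Literature.Analysis.FluidPDE.HardSphereFlow (Literature.Analysis.FluidPDE.Torus.geometry (Fin 3)) ε n) (g : Literature.Analysis.FluidPDE.Config n (Fin 3) Literature.MathematicalPhysics.KineticTheory.T3 → Fin n → Fin n → ℝ), (∀ i j, Measurable fun y => g y i j) → ∀ a : ℝ, 0 ≤ a → ∀ b : ℝ, Measurable fun z : Φ.good => Φ.collisionPairSum (Set.Ioc a b) (fun _ y i j => g y i j) (z : Literature.Analysis.FluidPDE.Config n (Fin 3) Literature.MathematicalPhysics.KineticTheory.T3)) :=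
  ⟨fun _ ρs us _ _ R K _ _ N hA hA₄ hσ Φ _ hz _ _ _ hS => abs_collisionPairSum_visCollTermN_le ρs us R K N hA hA₄ hσ Φ hz hS,
    fun _ _ Φ _ hg _ ha b => measurable_collisionPairSum_Ioc_comp_subtype Φ hg ha b⟩

end Summit.AtomisticToContinuum.HydrodynamicLimit.Theorems.LTEInBand

end
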